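import Literature.MathematicalPhysics.QuantumFieldTheory.BalabanImbrieJaffe1984to88.BIJ85NeumannPropagatorRegularDecay
import Literature.MathematicalPhysics.QuantumFieldTheory.Balaban1983to89.B1Ineq226RegularRegionSum
import Literature.MathematicalPhysics.QuantumFieldTheory.Balaban1983to89.B3Bound323ZeroTorus

/-!
# `BalabanImbrieJaffe1984to88.BIJ85NeumannPropagatorRegularClose` — T. Bałaban, J. Imbrie, A. Jaffe, *Renormalization of the Higgs model:
# minimizers, propagators and the stability of mean field theory*, Commun. Math. Phys. **97** (1985) 299–329 [BalabanImbrieJaffe1985], §7.3 p. 326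
# [PDF 28] «The propagators arising from Δ_k(u_k) … also satisfy the regularity and decay estimates of [7]», [7] = T. Bałaban, *Regularity and decay
# of lattice Green's functions*, Commun. Math. Phys. **89** (1983) 571–597 [Balaban1983RegularityDecay] Theorem p. 573 (1.11)–(1.12), [B1] = T. Bałaban,
# *(Higgs)₂,₃ quantum fields in a finite volume. I*, Commun. Math. Phys. **85** (1982) 603–626 [Balaban1982Higgs1] Prop. 2.1 (2.26) pp. 610–611:
# **THE `δG_k(Ω, Ω₀)` CLOSENESS MEMBER (1.11)–(1.12)/(2.26), VALUE FORM, FOR THE REGION NEUMANN PROPAGATORS `G_k(Ω,u)`, `G_k(Ω₀,u)` OF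
# [BalabanImbrieJaffe1988] (2.27)/(5.6.10) (p31's `gBox (α_kL^{kd}) ε⁻¹ u k Ω`) ON NESTED BIG-BLOCK REGIONS `Ω ⊆ Ω₀` AT `u = e^{ieεA}` WITH `A`
# (2.23)-REGULAR ON `Ω₀` — PROVED from p35's [B1] Prop. 2.1 (2.26) for regions (`B1Ineq226RegularRegionSum.deltaG_region_reg_decay_sum`) BY NAME
# through the non-zero-field dictionary (`BIJ85CovariantHiggsDictionary`), the `ε`-scaling at fixed charge and the massive problems `m² = t² ↓ 0`
# of the companion file `BIJ85NeumannPropagatorRegularDecay` (the (1.10)/(2.25) decay member, same seat).**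

statement-level skeleton of published theorems with citation tags; proofs where landed; nothing here is a claim about the Yang–Mills mass gap

PDFs held: `paper:balaban1985-cmp97-bij-higgs-minimizers` (journal page = PDF page + 298; p. 326 [PDF 28]); `paper:balaban1982-cmp85-higgs23-i`
(journal page = PDF page + 602; pp. 610–611 [PDF 8–9], materialised and re-read 2026-08-23); `paper:balaban1983-cmp89-regularity-decay` (journal
page = PDF page + 570; p. 573 [PDF 3], materialised and re-read 2026-08-23).

CITATION HEADER (lean-in-tree rule).  Cell `lit-balaban` (HOME `run/shared/lean/pub/lit-balaban/`), Phase 2, reader seat **r01 gen 26** (unit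
`lit-balaban-r01`, literature-prover-lit-balaban-r01-g26-0; B4 fold owner), free-target protocol G.5-34(d), TAKING line HOME/STATUS.md
2026-08-23T00:42:06Z (signal: p31 gen 20's STATUS line 2026-08-23T00:33:50Z «For p34/r01/p30: land your non-flat (1.10)/(1.12) in these shapes
and the chain instantiates by name» about the displayed inputs (H1.10)/(H1.12) of `BIJ88DeltaLocClose235General`).  Rows served (cells only, no
head change): **B4.Thm@573** (owner r01: the C2-carrier instance of [7]'s Theorem p. 573 at `A ≠ 0`, the `δG` clause (1.11)–(1.12), value member,
REGIONS), **C1.Eq7.3.1-7.3.2** (owner r15: the `δG` half of the p. 326 sentence for the REGION propagators), **C2.Eq2.31** (owner r18: the input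
(1.12) of (2.31) at a regular non-flat `u`, in the print's row-restricted form).  USED BY NAME, never restated: p35's
`B1Ineq226RegularRegionSum.deltaG_region_reg_decay_sum` and `B1Ineq225RegularRegion.norm_propagatorK_region_reg_decay_sum` (with their vocabulary
`B1TorusCubeCover.half`, `B1TorusCubeLocality26.rS`, `B1TorusRegionHSizes.IsBigBlockUnion`, `B1TorusRegionRop.chi`), typer's `HiggsLattice` /
`HiggsCovariance` and `HiggsRescaling.Params.scaleBy`/`mesh_scaleBy`, p31's `BIJ88NeumannPropagator227Torus` (`nOp`, `nPad`, `gBox`, `proj`,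
`isUnit_nPad`, `nOp_mul_gBox`), p11's `BIJ88NeumannNoZeroModesTorus.IsBlockUnion`, pv07's `Setup`/`B1RG242Torus.α`, r16's
`LatticeFieldCalculus.supDist`, p38's `B5Ineq137Torus.T` with p26/p03's `B3Bound323ZeroTorus.T_eq_supDist`, this seat's dictionary
`BIJ85CovariantHiggsDictionary` (`rotCharge`, `higgsOf`, `eSite`, `expGauge`, `vecH`, `rfield`, `regH`, `propagatorK_rfield_eq`,
`gBox_mulVec_eq_zero_of_not_mem`, `proj_mulVec_eq_self`, `toE`) and this seat's `BIJ85NeumannPropagatorRegularDecay` (`propagatorK_scaleBy_div`,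
`isBlockUnion_of_bigBlocks`, `isBigBlockUnion_regH`, `supDist_eSite`, `chi_smul_eq`, `support_of_massive_eq`, `isUnit_nOp_add_mass`,
`norm_massive_solution_le`, `norm_gBox_mulVec_le`, `norm_gBox_univ_mulVec_le`).

WHAT IS PRINTED (verbatim, re-read on the materialised pages).  [BIJ85] p. 326 [PDF 28]: *«The propagators arising from Δ_k(u_k), under the
restriction (7.3.1) on the gauge field, also satisfy the regularity and decay estimates of [7]. In order to remain within the framework of this
reference, we remark that by change of gauge u_k can be transformed in a local region Λ into a configuration of the form exp[ie_kηA], where A is smooth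
and small.»*  [7] p. 573 [PDF 3]: *«Similarly |(D^η_{A,μ}G_k(Ω, A)f)(x)|, |(G_k(Ω, A)(x)| ≦ c₀exp(−δ₀dist(x, supp f))‖f‖_∞ (1.10) for x ∈ Ω,
dist(x, Ω^c) ≧ R₀. If Ω ⊂ Ω₀, then for δG_k(Ω, Ω₀, A) defined by the equality δG_k(Ω, Ω₀, A) = G_k(Ω, A) − G_k(Ω₀, A), (1.11) we have the
inequalities (1.5) and (1.6) [sic: (1.9) and (1.10)] (with the same restrictions on x, x′) with the additional factor [(1.12), the display is blank on
the scan; [B1] prints it:] on the right hand sides. For some simple sets Ω, e.g. for rectangular parallelepipeds, the inequalities hold without any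
restrictions on the points x, x′, i.e. for all x, x′ ∈ Ω.»*  [B1] pp. 610–611 [PDF 8–9]: *«If Ω ⊂ Ω₀, then for δG_k(Ω, Ω₀, A) defined by the equality
δG_k(Ω, Ω₀, A) = G_k(Ω, A) − G_k(Ω₀, A), (2.26) we have the inequalities (2.24), (2.25) with the additional factor exp(−δ₀ dist(supp f, Ω^c) −
δ₀ dist({x, x′}, Ω^c)) on the right sides. For some simple sets Ω, e.g. for rectangular parallelepipeds, the inequalities hold without any restrictions
on the points x, x′, i.e. for all x, x′ ∈ Ω. Let us notice that Ω^c means a complement in T_η so in the case Ω = T_η the condition dist({x, x′}, Ω^c)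
≧ R₀ is meaningless and is omitted.»*  So: the restriction `dist(x, Ω^c) ≧ R₀` refers to the SMALLER set `Ω`, and both distances of the factor are
distances to `Ω^c = T_η ∖ Ω` (not to `Ω₀ ∖ Ω`).

WHAT THIS FILE PROVES (kernel-checked, 0 `sorry`; theorems only — no definition, no `Prop` fact).
* §1 **`norm_massive_diff_le`** — (2.26) transferred to the massive `Setup` problems UNIFORMLY in `m² = t² ∈ (0,1]`: for `Ω ⊆ Ω₀` big-block unions,
  `A` (2.23)-regular on `Ω₀`, a site `x` with `{|y − x| ≦ 2rS + 2L^kL^s(d+1) + 1} ⊂ Ω`, a source `h` supported in `Ω` with `|h| ≦ M`, `h = 0` within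
  distance `< D` of `x`, `D₀ ≦ dist(x, Ω^c)`, `D₁ ≦ dist(supp h, Ω^c)`, and the `Ω`- resp. `Ω₀`-supported solutions `ψ`, `ψ₀` of
  `(nOp_Ω + t²)ψ = h`, `(nOp_{Ω₀} + t²)ψ₀ = h`:  `‖ψ(x) − ψ₀(x)‖ ≦ c₀(L^kε)²e^{−(D+D₀+D₁)/(8L^sL^k)}M` — p35's inner (2.26) statement as the hypothesis
  `hB2`, applied on the torus `(higgsOf P s).scaleBy t` (`ψ_ℝ = G^ε_k(Ω_H,A_H;t²)h_ℝ = t⁻²G^{tε}_k(Ω_H,t⁻¹A_H;1)h_ℝ`, same for `Ω₀`; mesh `tL^kε ≦ 1`,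
  (2.23) scale-invariant; big blocks, `R₀`, supports and the three distances are labels — `supDist_eSite`).
* §2 **`norm_gBox_sub_gBox_mulVec_le`** — THE p. 326 SENTENCE, `δG` CLAUSE, REGION PROPAGATORS: for `d ≧ 1`, `L ≧ 2`, `a > 0`, `e`, `(c, β)`:
  `∃ s₀, ∀ s ≧ s₀, ∃ c₀ e₁ > 0` such that on every `Setup` torus (`d`, `L`), at every level `1 ≦ k ≦ K` with `k + s ≦ m + K`, `3L^kL^s ≦ 2L^{m+K}`, for
  every pair `Ω ⊆ Ω₀` of unions of big blocks (`L^k·L^s` sites per side), every `A` with `L^kε|e|/e_k·|∂A| ≦ ce_k^{β−1}/L^k` on `Ω₀`, `0 < e_k ≦ e₁`,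
  every `x` with `{|y − x| ≦ 2rS + 2L^kL^s(d+1) + 1} ⊂ Ω` and every `f` supported in `Ω` with `|f| ≦ M` vanishing on `{|z − x| < D}`, all
  `D₀ ≦ dist(x, Ω^c)`, `D₁ ≦ dist(supp f, Ω^c)` (`ℓ^∞` torus distances in fine-lattice steps):
  `‖(G_k(Ω,u)f)(x) − (G_k(Ω₀,u)f)(x)‖ ≦ c₀(L^kε)²·exp(−(D + D₀ + D₁)/(8L^s·L^k))·M` — p35's (2.26) theorem BY NAME at `m² = 1`, `ε₀ = 1`, `N = 2`,
  `K₀ = L^s` (§1); the massive problems on `Ω` and `Ω₀` (`isUnit_nOp_add_mass`); the two resolvent identities `G_k(X,u)f = ψ^X_{t²}(f) +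
  t²ψ^X_{t²}(G_k(X,u)f)` (`X = Ω, Ω₀`); the companion file's `norm_massive_solution_le` ((2.25), `D = 0`) for the two `t²`-terms; `t ↓ 0`
  (`le_of_forall_pos_le_add`).  **`norm_gBox_sub_gBox_apply_le`** — the kernel form, `y ∈ Ω`:  `|G_k(Ω,u;x,y) − G_k(Ω₀,u;x,y)| ≦
  c₀(L^kε)²e^{−(|x−y| + dist(x,Ω^c) + dist(y,Ω^c))/(8L^sL^k)}` (with any admissible minorants of the two boundary distances).
* §3 **`norm_gBox_sub_gBox_univ_mulVec_le`** — the pair `Ω ⊂ Ω₀ = T^{(0)}` (the whole torus is trivially a big-block union): `A` regular on `T^{(0)}`.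
* §4 THE INPUT SHAPES OF p31's `BIJ88DeltaLocClose235General` AT A REGULAR `u = e^{ieεA}`, in its level-`k` units (`s_k²·c₀·e^{−δ₀D/L^k}`, p38's
  metric `B5Ineq137Torus.T` = `supDist` by `B3Bound323ZeroTorus.T_eq_supDist`), with `δ₀ = 1/(4L^s)` resp. `1/(8L^s)`:
  **`input110_regular_univ`** — (H1.10) EXACTLY as displayed there for `X = T^{(0)}` (every row; the companion file's
  `norm_gBox_univ_mulVec_le`); **`input110_regular_deep`** — (H1.10) for a big-block union `X` at the rows `x` with `{|y − x| ≦ R₀′} ⊂ X`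
  (`R₀′ = 2rS + 2L^kL^s(d+1)`; the print's «for x ∈ Ω, dist(x, Ω^c) ≧ R₀»); **`input112_regular_deep`** — (H1.12′): p31's (H1.12) with its two
  modifications forced by the print at `A ≠ 0` — rows `x` with `{|y − x| ≦ R₀′ + 1} ⊂ □` («with the same restrictions on x»), and `D_b, D_f`
  minorants of the distances from `x`, resp. `supp f`, to `T ∖ □` («Ω^c means a complement in T_η»; p31 displays distances to `Ω₀ ∖ □`, which [7]
  prints «without any restrictions» only for parallelepipeds, and which holds at `A = 0` by b04's `B4Delta112ZeroBox`).
HONEST SCOPE.  (i) VALUE member only: the derivative member `|D^η_{A,μ}δG_k|` and the Hölder member of (1.12)/(2.26) are not treated here (p35's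
theorem carries the derivative member; its transfer needs the dictionary for `covDeriv`, not built).  (ii) `u` is EXACTLY `e^{ieεA}` with a real bond
field `A` regular on `Ω₀` (the «change of gauge» of the quoted sentence is not performed; gauge covariance of `gBox` is p31's (5.6.11)–(5.6.12)).
(iii) Constants: prefactor `(L^kε)²`, rate `1/(8L^s)` per `L^kε`-step in the three distances (p35's, `M = K₀ = L^s`; half the (2.25) rate, as
printed «(2M)⁻¹»); thresholds `e₁`, `s₀` existential (p35's `K₀min` of the (2.25) and (2.26) theorems, whichever is larger).  (iv) `N = 2`
(abelian Higgs); `R₀` in the site form `{|y − x| ≦ 2rS + 2L^kL^s(d+1) + 1} ⊂ Ω` (so in particular `x ∈ Ω`; no statement at the rows of `Ω`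
closer than `R₀′ + 1` to `T ∖ Ω` — the print's restriction; the parallelepiped waiver is not formalised here); distances to `T ∖ Ω`.  (v) Not a
restatement: no (1.12)-type bound for `gBox` at a non-flat field existed in the tree (flat: b04/r01/p31 gen 17; small fields: none).
Unit `lit-balaban-r01` gen 26 (literature-prover-lit-balaban-r01-g26-0), 2026-08-23.  NOT summit progress.
-/

namespace Literature.MathematicalPhysics.QuantumFieldTheory.BalabanImbrieJaffe1984to88.BIJ85NeumannPropagatorRegularClose

open Literature.MathematicalPhysics.QuantumFieldTheory.Balaban1983to89
open HiggsLattice (ChargeData)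
open HiggsCovariance (propagatorK)
open HiggsRescaling (mesh_scaleBy)
open BIJ85CovariantHiggsDictionary
open BIJ85NeumannPropagatorRegularDecay (propagatorK_scaleBy_div isBlockUnion_of_bigBlocks isBigBlockUnion_regH supDist_eSite
  chi_smul_eq support_of_massive_eq isUnit_nOp_add_mass norm_massive_solution_le norm_gBox_mulVec_le norm_gBox_univ_mulVec_le)
open BIJ88Sect3Statements (U1)
open BIJ88NeumannPropagator227Torus (nOp nPad gBox proj proj_mulVec nOp_mul_gBox isUnit_nPad)
open BIJ88NeumannNoZeroModesTorus (IsBlockUnion)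
open scoped BigOperators Matrix
open Finset Matrix

noncomputable section

/-! ## §1 [B1] (2.26) at (2.23)-regular `A`, transferred to the massive `Setup` problems at every `m² ∈ (0, 1]` -/

section Massive

variable {P : Params} {s : ℕ}

/-- **THE CLOSENESS OF THE MASSIVE SOLUTIONS ON `Ω ⊆ Ω₀`, UNIFORMLY IN `m² = t² ∈ (0,1]`**: if p35's [B1] Prop. 2.1 (2.26) bound holds with the
constants `(L^s, c₀, e₁)` at `m² = 1`, mesh cap `1` (hypothesis `hB2` — the inner statement of `B1Ineq226RegularRegionSum.deltaG_region_reg_decay_sum`,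
discharged BY NAME in `norm_gBox_sub_gBox_mulVec_le`), then on a `Setup` torus with `L`, `d` as there, for big-block unions `Ω ⊆ Ω₀` (blocks
`L^k·L^s`), a field `A` (2.23)-regular on `Ω₀` (`0 < e_k ≦ e₁`), a site `x` with `{|y − x| ≦ 2rS + 2L^kL^s(d+1) + 1} ⊂ Ω`, a source `h` supported
in `Ω` with `|h| ≦ M`, `h = 0` within distance `< D` of `x`, `D₀ ≦ dist(x, T∖Ω)`, `D₁ ≦ dist(supp h, T∖Ω)`, and the `Ω`-, resp. `Ω₀`-supported
solutions of `(nOp (α_kL^{kd}) ε⁻¹ e^{ieεA} k Ω + t²)ψ = h`, `(nOp … k Ω₀ + t²)ψ₀ = h`: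
`‖ψ(x) − ψ₀(x)‖ ≦ c₀(L^kε)²e^{−(D+D₀+D₁)/(8L^sL^k)}M` — by the ε-scaling `t`: `ψ_ℝ = G^ε_k(Ω_H,A_H;t²)h_ℝ = t⁻²G^{tε}_k(Ω_H,t⁻¹A_H;1)h_ℝ`
(and the same on `Ω₀`) and (2.26) on the `tε`-torus (mesh `tL^kε ≦ 1`, (2.23) scale-invariant, the distances are labels).
[cite: Balaban1982Higgs1, Prop. 2.1 (2.26) pp.610–611] -/
theorem norm_massive_diff_le (d L s : ℕ) {a : ℝ} (ha : 0 < a) (e creg β c₀ e₁ : ℝ)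
    (hB2 : ∀ (P' : HiggsLattice.Params), P'.d = d → P'.L = L → L ^ s ∣ P'.M →
      ∀ {K : ℕ}, 1 ≤ K → K ≤ P'.K → (∀ μ, 3 * B1TorusCubeCover.half P' K (L ^ s) ≤ P'.sitesPerDir 0 μ) → P'.mesh K ≤ 1 →
      ∀ (Ω' Ω₀' : Finset (HiggsLattice.Site P' 0)), B1TorusRegionHSizes.IsBigBlockUnion K (L ^ s) Ω' →
        B1TorusRegionHSizes.IsBigBlockUnion K (L ^ s) Ω₀' → Ω' ⊆ Ω₀' →
      ∀ (A' : HiggsLattice.VecField P' 0) {ec : ℝ}, 0 < ec → ec ≤ e₁ →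
      (∀ z ∈ Ω₀', ∀ μ ν : Fin P'.d,
          P'.mesh K * |(rotCharge e).e| / ec * |A' ⟨z.shift μ, ν⟩ - A' ⟨z, ν⟩| ≤ creg * ec ^ (β - 1) / (P'.L : ℝ) ^ K) →
      ∀ (x : HiggsLattice.Site P' 0),
        (∀ y, HiggsLattice.Site.tdist x y
            ≤ 2 * B1TorusCubeLocality26.rS P' K (L ^ s) + 2 * B1TorusCubeCover.half P' K (L ^ s) * (P'.d + 1) + 1 → y ∈ Ω') →
        ∀ (g : HiggsLattice.ScalarField P' 0 2) (M D D₀ D₁ : ℝ), (∀ y, ‖g y‖ ≤ M) → 0 ≤ D → 0 ≤ D₀ → 0 ≤ D₁ →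
          (∀ z, g z ≠ 0 → D ≤ (HiggsLattice.Site.tdist x z : ℝ)) →
          (∀ z, z ∉ Ω' → D₀ ≤ (HiggsLattice.Site.tdist x z : ℝ)) →
          (∀ y z, g y ≠ 0 → z ∉ Ω' → D₁ ≤ (HiggsLattice.Site.tdist z y : ℝ)) →
            ‖(propagatorK (rotCharge e) Ω' A' 1 a K (B1TorusRegionRop.chi Ω' • g)
                - propagatorK (rotCharge e) Ω₀' A' 1 a K (B1TorusRegionRop.chi Ω₀' • g)) x‖
              ≤ c₀ * P'.mesh K ^ 2 * Real.exp (-((D + D₀ + D₁) / (8 * (L ^ s : ℕ) * (P'.L : ℝ) ^ K))) * M ∧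
            ∀ μ : Fin P'.d,
              ‖HiggsLattice.covDeriv (rotCharge e) A' (propagatorK (rotCharge e) Ω' A' 1 a K (B1TorusRegionRop.chi Ω' • g)
                  - propagatorK (rotCharge e) Ω₀' A' 1 a K (B1TorusRegionRop.chi Ω₀' • g)) ⟨x, μ⟩‖
                ≤ c₀ * P'.mesh K * Real.exp (-((D + D₀ + D₁) / (8 * (L ^ s : ℕ) * (P'.L : ℝ) ^ K))) * M)
    (P : Params) (hPd : P.d = d) (hPL : P.L = L) (hs : 0 + s ≤ P.m + P.K) {k : ℕ} (hk1 : 1 ≤ k) (hkK : k ≤ P.K)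
    (hks : k + s ≤ P.m + P.K) (hsize : 3 * (L ^ k * L ^ s) ≤ P.sitesPerDir 0)
    {Ω Ω₀ : Finset (Balaban1983to89.Site P 0)}
    (hbig : ∀ z z' : Balaban1983to89.Site P 0,
      (∀ μ, (z μ).val / (L ^ k * L ^ s) = (z' μ).val / (L ^ k * L ^ s)) → (z ∈ Ω ↔ z' ∈ Ω))
    (hbig₀ : ∀ z z' : Balaban1983to89.Site P 0,
      (∀ μ, (z μ).val / (L ^ k * L ^ s) = (z' μ).val / (L ^ k * L ^ s)) → (z ∈ Ω₀ ↔ z' ∈ Ω₀))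
    (hsub : Ω ⊆ Ω₀)
    (A : PBond P 0 → ℝ) {ec : ℝ} (hec : 0 < ec) (hece : ec ≤ e₁)
    (hreg : ∀ z ∈ Ω₀, ∀ μ ν : Fin P.d,
      P.spacing k * |e| / ec * |A ⟨z.shift μ, ν⟩ - A ⟨z, ν⟩| ≤ creg * ec ^ (β - 1) / (L : ℝ) ^ k)
    (x : Balaban1983to89.Site P 0)
    (hint : ∀ y, LatticeFieldCalculus.supDist x y
      ≤ 2 * (5 * (L ^ k * L ^ s) / 8 + L ^ k) + 2 * (L ^ k * L ^ s) * (d + 1) + 1 → y ∈ Ω)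
    {t : ℝ} (ht : 0 < t) (ht1 : t ≤ 1) {ψ ψ₀ h : Balaban1983to89.Site P 0 → ℂ} (hψ : ∀ z, z ∉ Ω → ψ z = 0)
    (hψ₀ : ∀ z, z ∉ Ω₀ → ψ₀ z = 0) (hh : ∀ z, z ∉ Ω → h z = 0)
    (heq : nOp (B1RG242Torus.α P a k * (P.L : ℝ) ^ (k * P.d)) P.eps⁻¹ (expGauge P e A) k Ω *ᵥ ψ + ((t ^ 2 : ℝ) : ℂ) • ψ = h)
    (heq₀ : nOp (B1RG242Torus.α P a k * (P.L : ℝ) ^ (k * P.d)) P.eps⁻¹ (expGauge P e A) k Ω₀ *ᵥ ψ₀ + ((t ^ 2 : ℝ) : ℂ) • ψ₀ = h)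
    (M D D₀ D₁ : ℝ) (hM : ∀ z, ‖h z‖ ≤ M) (hD : 0 ≤ D) (hD₀ : 0 ≤ D₀) (hD₁ : 0 ≤ D₁)
    (hsupp : ∀ z, h z ≠ 0 → D ≤ (LatticeFieldCalculus.supDist x z : ℝ))
    (hxD₀ : ∀ z, z ∉ Ω → D₀ ≤ (LatticeFieldCalculus.supDist x z : ℝ))
    (hhD₁ : ∀ y z, h y ≠ 0 → z ∉ Ω → D₁ ≤ (LatticeFieldCalculus.supDist z y : ℝ)) :
    ‖ψ x - ψ₀ x‖ ≤ c₀ * P.spacing k ^ 2 * Real.exp (-((D + D₀ + D₁) / (8 * (L : ℝ) ^ s * (L : ℝ) ^ k))) * M := by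
  subst hPd hPL
  have hak : 0 ≤ B1.aSeq a (P.L : ℝ) k := (B1.aSeq_pos ha (B1RG242Torus.one_lt_cast_L P) hk1).le
  have hΩ : IsBlockUnion k Ω := isBlockUnion_of_bigBlocks (s := s) (by omega) hbig
  have hΩ₀ : IsBlockUnion k Ω₀ := isBlockUnion_of_bigBlocks (s := s) (by omega) hbig₀
  have hh₀ : ∀ z, z ∉ Ω₀ → h z = 0 := fun z hz => hh z fun hz' => hz (hsub hz')
  have hsubH : regH P s hs Ω ⊆ regH P s hs Ω₀ := fun y hy =>
    (mem_regH hs Ω₀ y).2 (hsub ((mem_regH hs Ω y).1 hy))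
  -- the site `x` read on the Higgs torus
  obtain ⟨xH, rfl⟩ : ∃ xH, eSite P s rfl hs xH = x := ⟨(eSite P s rfl hs).symm x, Equiv.apply_symm_apply _ _⟩
  -- (2.20): the realified solutions are the [B1] propagator columns at `m² = t²`
  have hcol := propagatorK_rfield_eq hs hks e A (pow_pos ht 2) hak hΩ hψ heq
  have hcol₀ := propagatorK_rfield_eq hs hks e A (pow_pos ht 2) hak hΩ₀ hψ₀ heq₀
  -- the ε-scaling to `m² = 1`
  have hsc := propagatorK_scaleBy_div (Q := higgsOf P s) ht (rotCharge e) (regH P s hs Ω) (vecH P s hs A) a k hak (rfield P s hs h)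
  have hsc₀ := propagatorK_scaleBy_div (Q := higgsOf P s) ht (rotCharge e) (regH P s hs Ω₀) (vecH P s hs A) a k hak (rfield P s hs h)
  -- [B1] (2.26) on the `tε`-torus
  have hb := (hB2 ((higgsOf P s).scaleBy t ht) rfl rfl (dvd_refl _) hk1 (show k ≤ P.m + P.K - s by omega)
    (fun μ => by
      rw [show ((higgsOf P s).scaleBy t ht).sitesPerDir 0 μ = P.sitesPerDir 0 from higgsOf_sitesPerDir hs μ]
      exact hsize)
    (by
      rw [mesh_scaleBy, higgsOf_mesh]
      refine mul_le_one₀ ht1 (P.spacing_pos k).le ?_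
      rw [← P.spacing_K]
      exact mul_le_mul_of_nonneg_right (pow_le_pow_right₀ (B1RG242Torus.one_lt_cast_L P).le hkK) P.eps_pos.le)
    (regH P s hs Ω) (regH P s hs Ω₀) (isBigBlockUnion_regH hs hbig ht) (isBigBlockUnion_regH hs hbig₀ ht) hsubH
    (fun b => t⁻¹ * vecH P s hs A ⟨b.src, b.dir⟩) hec hece
    (fun z hz μ ν => by
      have hz' : eSite P s rfl hs z ∈ Ω₀ := (mem_regH hs Ω₀ z).1 hz
      rw [mesh_scaleBy, higgsOf_mesh, rotCharge_e]
      show t * P.spacing k * |e| / ec * |t⁻¹ * vecH P s hs A ⟨HiggsLattice.Site.shift (P := higgsOf P s) z μ, ν⟩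
          - t⁻¹ * vecH P s hs A ⟨z, ν⟩| ≤ creg * ec ^ (β - 1) / (P.L : ℝ) ^ k
      rw [vecH_apply, vecH_apply, eSite_shift, ← mul_sub, abs_mul, abs_of_pos (inv_pos.2 ht),
        show t * P.spacing k * |e| / ec * (t⁻¹ * |A ⟨(eSite P s rfl hs z).shift μ, ν⟩ - A ⟨eSite P s rfl hs z, ν⟩|)
          = P.spacing k * |e| / ec * |A ⟨(eSite P s rfl hs z).shift μ, ν⟩ - A ⟨eSite P s rfl hs z, ν⟩| by
            field_simp]
      exact hreg _ hz' μ ν)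
    xH
    (fun y hy => (mem_regH hs Ω y).2 (hint _ (by
      rw [supDist_eSite]
      exact hy)))
    (rfield P s hs h) M D D₀ D₁ (fun y => by rw [norm_rfield_apply]; exact hM _) hD hD₀ hD₁
    (fun z hz => by
      have hz' : h (eSite P s rfl hs z) ≠ 0 := fun h0 => hz (by rw [rfield_apply, h0, map_zero])
      have := hsupp _ hz'
      rw [supDist_eSite] at this
      exact this)
    (fun z hz => by
      have hz' : eSite P s rfl hs z ∉ Ω := fun h' => hz ((mem_regH hs Ω z).2 h')
      have := hxD₀ _ hz'
      rw [supDist_eSite] at this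
      exact this)
    (fun y z hy hz => by
      have hy' : h (eSite P s rfl hs y) ≠ 0 := fun h0 => hy (by rw [rfield_apply, h0, map_zero])
      have hz' : eSite P s rfl hs z ∉ Ω := fun h' => hz ((mem_regH hs Ω z).2 h')
      have := hhD₁ _ _ hy' hz'
      rw [supDist_eSite] at this
      exact this)).1
  -- assemble
  have hchi := chi_smul_eq hs hh ht (Ω := Ω) (rfield P s hs h) fun _ => rfl
  have hchi₀ := chi_smul_eq hs hh₀ ht (Ω := Ω₀) (rfield P s hs h) fun _ => rfl
  rw [hchi, hchi₀] at hb
  have hb' : ‖(propagatorK (P := (higgsOf P s).scaleBy t ht) (rotCharge e) (regH P s hs Ω)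
      (fun b => t⁻¹ * vecH P s hs A ⟨b.src, b.dir⟩) 1 a k (rfield P s hs h)
      - propagatorK (P := (higgsOf P s).scaleBy t ht) (rotCharge e) (regH P s hs Ω₀)
      (fun b => t⁻¹ * vecH P s hs A ⟨b.src, b.dir⟩) 1 a k (rfield P s hs h)) xH‖
        ≤ c₀ * ((higgsOf P s).scaleBy t ht).mesh k ^ 2
          * Real.exp (-((D + D₀ + D₁) / (8 * (P.L ^ s : ℕ) * (((higgsOf P s).scaleBy t ht).L : ℝ) ^ k))) * M := hb
  rw [mesh_scaleBy, higgsOf_mesh, Nat.cast_pow, show (((higgsOf P s).scaleBy t ht).L : ℝ) = P.L from rfl] at hb'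
  have hval : ψ (eSite P s rfl hs xH) - ψ₀ (eSite P s rfl hs xH)
      = toE.symm (t⁻¹ ^ 2 • (propagatorK (P := (higgsOf P s).scaleBy t ht) (rotCharge e) (regH P s hs Ω)
          (fun b => t⁻¹ * vecH P s hs A ⟨b.src, b.dir⟩) 1 a k (rfield P s hs h)
          - propagatorK (P := (higgsOf P s).scaleBy t ht) (rotCharge e) (regH P s hs Ω₀)
          (fun b => t⁻¹ * vecH P s hs A ⟨b.src, b.dir⟩) 1 a k (rfield P s hs h)) xH) := by
    have h1 := congrFun hcol xH
    have h1₀ := congrFun hcol₀ xH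
    have h2 := congrFun hsc xH
    have h2₀ := congrFun hsc₀ xH
    rw [rfield_apply] at h1 h1₀
    apply toE.injective
    rw [LinearIsometryEquiv.apply_symm_apply, map_sub, ← h1, ← h1₀, Pi.sub_apply]
    show _ = t⁻¹ ^ 2 • ((propagatorK (P := (higgsOf P s).scaleBy t ht) (rotCharge e) (regH P s hs Ω)
          (fun b => t⁻¹ * vecH P s hs A ⟨b.src, b.dir⟩) 1 a k (rfield P s hs h)) xH
        - (propagatorK (P := (higgsOf P s).scaleBy t ht) (rotCharge e) (regH P s hs Ω₀)
          (fun b => t⁻¹ * vecH P s hs A ⟨b.src, b.dir⟩) 1 a k (rfield P s hs h)) xH)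
    rw [h2, h2₀]
    show _ = t⁻¹ ^ 2 • (t ^ 2 • (propagatorK (rotCharge e) (regH P s hs Ω) (vecH P s hs A) (t ^ 2) a k) (rfield P s hs h) xH
        - t ^ 2 • (propagatorK (rotCharge e) (regH P s hs Ω₀) (vecH P s hs A) (t ^ 2) a k) (rfield P s hs h) xH)
    rw [← smul_sub, smul_smul, show t⁻¹ ^ 2 * t ^ 2 = 1 by field_simp, one_smul]
  rw [hval, LinearIsometryEquiv.norm_map, norm_smul, Real.norm_of_nonneg (pow_nonneg (inv_pos.2 ht).le 2)]
  calc t⁻¹ ^ 2 * _ ≤ t⁻¹ ^ 2 * (c₀ * (t * P.spacing k) ^ 2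
        * Real.exp (-((D + D₀ + D₁) / (8 * (P.L : ℝ) ^ s * (P.L : ℝ) ^ k))) * M) :=
        mul_le_mul_of_nonneg_left hb' (pow_nonneg (inv_pos.2 ht).le 2)
    _ = _ := by field_simp

end Massive

/-! ## §2 [BIJ85] p.326 / [7] (1.11)–(1.12): the closeness `δG_k(Ω, Ω₀)` for the region Neumann propagators at `u = e^{ieεA}`, `A` regular -/

section Close

/-- **[BalabanImbrieJaffe1985] p.326 «The propagators arising from Δ_k(u_k) … also satisfy the regularity and decay estimates of [7]» — THE `δG`
CLAUSE [7] (1.11)–(1.12) = [B1] Prop. 2.1 (2.26), VALUE MEMBER, FOR THE REGION NEUMANN PROPAGATORS `G_k(Ω,u)`, `G_k(Ω₀,u)` OF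
[BalabanImbrieJaffe1988] (2.27)/(5.6.10) ON NESTED BIG-BLOCK REGIONS `Ω ⊆ Ω₀` AT `u = e^{ieεA}`.**  For `d ≧ 1`, `L ≧ 2`, `a > 0`, a charge `e` and
a regularity pair `(c, β)` there are a minimal big-block exponent `s₀` and, for every `s ≧ s₀`, constants `c₀, e₁ > 0` (depending on `d, a, L^s`
only) such that on every torus `T^{(0)} = (ℤ/2L^{m+K})^d`, `ε = L^{−K}`, at every level `1 ≦ k ≦ K` with `k + s ≦ m + K`, `3L^kL^s ≦ 2L^{m+K}`, for
every pair `Ω ⊆ Ω₀` of unions of big blocks (cubes of `L^k·L^s` sites on the `L^kL^s`-grid), every real bond field `A` with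
`L^kε·|e|/e_k·|A(⟨z+e_μ,ν⟩) − A(⟨z,ν⟩)| ≦ c·e_k^{β−1}/L^k` on `Ω₀` ((2.23), `0 < e_k ≦ e₁`), every site `x` with
`{y : |y − x| ≦ 2rS + 2L^kL^s(d+1) + 1} ⊂ Ω` («for x ∈ Ω, dist(x, Ω^c) ≧ R₀» — «with the same restrictions on x»), every `f` supported in `Ω`
with `|f| ≦ M`, `f = 0` on `{|z − x| < D}`, and all `D₀ ≦ dist(x, T∖Ω)`, `D₁ ≦ dist(supp f, T∖Ω)` (`ℓ^∞` torus distances; «Ω^c means a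
complement in T_η»):
`|(G_k(Ω,u)f)(x) − (G_k(Ω₀,u)f)(x)| ≦ c₀(L^kε)²·exp(−(D + D₀ + D₁)/(8L^s·L^k))·M`,
`G_k(X,u)` = p31's `gBox (α_kL^{kd}) ε⁻¹ u k X`, `u = expGauge e A`, `α_k = a_k(L^kε)^{−2}` — «the additional factor exp(−δ₀ dist(supp f, Ω^c) −
δ₀ dist({x, x′}, Ω^c)) on the right sides» with `δ₀ = 1/(8L^s)` per `L^kε`.
PROOF (kernel): p35's `B1Ineq226RegularRegionSum.deltaG_region_reg_decay_sum` BY NAME at `m² = 1` on the `tε`-tori through the dictionary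
(`norm_massive_diff_le`); the massive problems `(nOp_X + t²)ψ = ·` on `X = Ω, Ω₀` (`isUnit_nOp_add_mass`); the resolvent identities
`G_k(X,u)f = ψ^X_{t²}(f) + t²ψ^X_{t²}(G_k(X,u)f)`; the companion file's `norm_massive_solution_le` ((2.25) at `D = 0`) for the two `t²`-terms; `t ↓ 0`.
HONEST SCOPE: value member only; `u` exactly of the form `e^{ieεA}`; `N = 2`; `f` supported in `Ω`; rows deep inside `Ω`; distances to `T∖Ω`.
[cite: BalabanImbrieJaffe1985, p.326 «also satisfy the regularity and decay estimates of [7]»]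
[cite: Balaban1983RegularityDecay, Theorem p.573 (1.11)–(1.12)] [cite: Balaban1982Higgs1, Prop. 2.1 (2.26) pp.610–611] -/
theorem norm_gBox_sub_gBox_mulVec_le (d L : ℕ) (hd : 1 ≤ d) (hL : 2 ≤ L) {a : ℝ} (ha : 0 < a) (e creg β : ℝ) (hcreg : 0 ≤ creg)
    (hβ : 0 < β) :
    ∃ s₀ : ℕ, ∀ s : ℕ, s₀ ≤ s → ∃ c₀ e₁ : ℝ, 0 < c₀ ∧ 0 < e₁ ∧
      ∀ (P : Params), P.d = d → P.L = L → ∀ {k : ℕ}, 1 ≤ k → k ≤ P.K → k + s ≤ P.m + P.K →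
      3 * (L ^ k * L ^ s) ≤ P.sitesPerDir 0 →
      ∀ (Ω Ω₀ : Finset (Balaban1983to89.Site P 0)),
        (∀ z z' : Balaban1983to89.Site P 0,
          (∀ μ, (z μ).val / (L ^ k * L ^ s) = (z' μ).val / (L ^ k * L ^ s)) → (z ∈ Ω ↔ z' ∈ Ω)) →
        (∀ z z' : Balaban1983to89.Site P 0,
          (∀ μ, (z μ).val / (L ^ k * L ^ s) = (z' μ).val / (L ^ k * L ^ s)) → (z ∈ Ω₀ ↔ z' ∈ Ω₀)) →
        Ω ⊆ Ω₀ →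
      ∀ (A : PBond P 0 → ℝ) {ec : ℝ}, 0 < ec → ec ≤ e₁ →
      (∀ z ∈ Ω₀, ∀ μ ν : Fin P.d,
          P.spacing k * |e| / ec * |A ⟨z.shift μ, ν⟩ - A ⟨z, ν⟩| ≤ creg * ec ^ (β - 1) / (L : ℝ) ^ k) →
      ∀ (x : Balaban1983to89.Site P 0),
        (∀ y, LatticeFieldCalculus.supDist x y
          ≤ 2 * (5 * (L ^ k * L ^ s) / 8 + L ^ k) + 2 * (L ^ k * L ^ s) * (d + 1) + 1 → y ∈ Ω) →
      ∀ (f : Balaban1983to89.Site P 0 → ℂ) (M D D₀ D₁ : ℝ), (∀ z, ‖f z‖ ≤ M) → (∀ z, z ∉ Ω → f z = 0) →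
        0 ≤ D → 0 ≤ D₀ → 0 ≤ D₁ →
        (∀ z, f z ≠ 0 → D ≤ (LatticeFieldCalculus.supDist x z : ℝ)) →
        (∀ z, z ∉ Ω → D₀ ≤ (LatticeFieldCalculus.supDist x z : ℝ)) →
        (∀ y z, f y ≠ 0 → z ∉ Ω → D₁ ≤ (LatticeFieldCalculus.supDist z y : ℝ)) →
        ‖(gBox (B1RG242Torus.α P a k * (P.L : ℝ) ^ (k * P.d)) P.eps⁻¹ (expGauge P e A) k Ω *ᵥ f) x
            - (gBox (B1RG242Torus.α P a k * (P.L : ℝ) ^ (k * P.d)) P.eps⁻¹ (expGauge P e A) k Ω₀ *ᵥ f) x‖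
          ≤ c₀ * P.spacing k ^ 2 * Real.exp (-((D + D₀ + D₁) / (8 * (L : ℝ) ^ s * (L : ℝ) ^ k))) * M := by
  obtain ⟨K₁, hK₁⟩ :=
    B1Ineq225RegularRegion.norm_propagatorK_region_reg_decay_sum d L hd hL ha one_pos 2 (rotCharge e) 1 creg β hcreg hβ
  obtain ⟨K₂, hK₂⟩ :=
    B1Ineq226RegularRegionSum.deltaG_region_reg_decay_sum d L hd hL ha one_pos 2 (rotCharge e) 1 creg β hcreg hβ
  refine ⟨max K₁ K₂, fun s hs₀ => ?_⟩
  have hLs : s ≤ L ^ s := (Nat.lt_pow_self (by omega : 1 < L)).le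
  obtain ⟨c₁, e₁, hc₁, he₁, hB1⟩ := hK₁ (L ^ s) (le_trans (le_trans (le_max_left _ _) hs₀) hLs)
  obtain ⟨c₂, e₂, hc₂, he₂, hB2⟩ := hK₂ (L ^ s) (le_trans (le_trans (le_max_right _ _) hs₀) hLs)
  refine ⟨c₂, min e₁ e₂, hc₂, lt_min he₁ he₂, ?_⟩
  intro P hPd hPL k hk1 hkK hks hsize Ω Ω₀ hbig hbig₀ hsub A ec hec hece hreg x hint f M D D₀ D₁ hM hf hD hD₀ hD₁ hsupp hxD₀ hfD₁
  have hece₁ : ec ≤ e₁ := hece.trans (min_le_left _ _)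
  have hece₂ : ec ≤ e₂ := hece.trans (min_le_right _ _)
  have hak : 0 ≤ B1.aSeq a (P.L : ℝ) k := (B1.aSeq_pos ha (B1RG242Torus.one_lt_cast_L P) hk1).le
  have hα : 0 < B1RG242Torus.α P a k * (P.L : ℝ) ^ (k * P.d) :=
    mul_pos (mul_pos (B1.aSeq_pos ha (B1RG242Torus.one_lt_cast_L P) hk1) (inv_pos.2 (pow_pos (P.spacing_pos k) 2)))
      (pow_pos P.cast_L_pos _)
  have hs : 0 + s ≤ P.m + P.K := by omega
  have hbig' : ∀ z z' : Balaban1983to89.Site P 0,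
      (∀ μ, (z μ).val / (P.L ^ k * P.L ^ s) = (z' μ).val / (P.L ^ k * P.L ^ s)) → (z ∈ Ω ↔ z' ∈ Ω) := by
    rw [hPL]; exact hbig
  have hbig₀' : ∀ z z' : Balaban1983to89.Site P 0,
      (∀ μ, (z μ).val / (P.L ^ k * P.L ^ s) = (z' μ).val / (P.L ^ k * P.L ^ s)) → (z ∈ Ω₀ ↔ z' ∈ Ω₀) := by
    rw [hPL]; exact hbig₀
  have hΩ : IsBlockUnion k Ω := isBlockUnion_of_bigBlocks (s := s) (by omega) hbig'
  have hΩ₀ : IsBlockUnion k Ω₀ := isBlockUnion_of_bigBlocks (s := s) (by omega) hbig₀'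
  have hN := isUnit_nPad (j := 0) (by omega) (inv_ne_zero P.eps_pos.ne') hα (expGauge P e A) hΩ
  have hN₀ := isUnit_nPad (j := 0) (by omega) (inv_ne_zero P.eps_pos.ne') hα (expGauge P e A) hΩ₀
  -- (2.23) on `Ω`; the `R₀` condition of (2.25) (radius one less) for `Ω` and for `Ω₀`; `f` vanishes off `Ω₀`
  have hregΩ : ∀ z ∈ Ω, ∀ μ ν : Fin P.d,
      P.spacing k * |e| / ec * |A ⟨z.shift μ, ν⟩ - A ⟨z, ν⟩| ≤ creg * ec ^ (β - 1) / (L : ℝ) ^ k :=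
    fun z hz => hreg z (hsub hz)
  have hint' : ∀ y, LatticeFieldCalculus.supDist x y
      ≤ 2 * (5 * (L ^ k * L ^ s) / 8 + L ^ k) + 2 * (L ^ k * L ^ s) * (d + 1) → y ∈ Ω :=
    fun y hy => hint y (Nat.le_succ_of_le hy)
  have hint₀' : ∀ y, LatticeFieldCalculus.supDist x y
      ≤ 2 * (5 * (L ^ k * L ^ s) / 8 + L ^ k) + 2 * (L ^ k * L ^ s) * (d + 1) → y ∈ Ω₀ :=
    fun y hy => hsub (hint' y hy)
  have hf₀ : ∀ z, z ∉ Ω₀ → f z = 0 := fun z hz => hf z fun hz' => hz (hsub hz')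
  -- `g = G_k(Ω,u)f`, `g₀ = G_k(Ω₀,u)f`: supported in `Ω`, `Ω₀`, `nOp_Ω g = f`, `nOp_{Ω₀} g₀ = f`
  set g := gBox (B1RG242Torus.α P a k * (P.L : ℝ) ^ (k * P.d)) P.eps⁻¹ (expGauge P e A) k Ω *ᵥ f with hg
  set g₀ := gBox (B1RG242Torus.α P a k * (P.L : ℝ) ^ (k * P.d)) P.eps⁻¹ (expGauge P e A) k Ω₀ *ᵥ f with hg₀
  have hgsupp : ∀ z, z ∉ Ω → g z = 0 := fun z hz => gBox_mulVec_eq_zero_of_not_mem hN f hz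
  have hg₀supp : ∀ z, z ∉ Ω₀ → g₀ z = 0 := fun z hz => gBox_mulVec_eq_zero_of_not_mem hN₀ f hz
  have hNg : nOp (B1RG242Torus.α P a k * (P.L : ℝ) ^ (k * P.d)) P.eps⁻¹ (expGauge P e A) k Ω *ᵥ g = f := by
    rw [hg, mulVec_mulVec, nOp_mul_gBox hN, proj_mulVec_eq_self hf]
  have hNg₀ : nOp (B1RG242Torus.α P a k * (P.L : ℝ) ^ (k * P.d)) P.eps⁻¹ (expGauge P e A) k Ω₀ *ᵥ g₀ = f := by
    rw [hg₀, mulVec_mulVec, nOp_mul_gBox hN₀, proj_mulVec_eq_self hf₀]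
  -- at every `τ = t² ∈ (0,1]`: the two resolvent identities and the three massive bounds
  have key : ∀ τ : ℝ, 0 < τ → τ ≤ 1 →
      ‖g x - g₀ x‖ ≤ c₂ * P.spacing k ^ 2 * Real.exp (-((D + D₀ + D₁) / (8 * (L : ℝ) ^ s * (L : ℝ) ^ k))) * M
        + τ * (c₁ * P.spacing k ^ 2 * Real.exp (-(0 / (4 * (L : ℝ) ^ s * (L : ℝ) ^ k))) * ∑ z, ‖g z‖
          + c₁ * P.spacing k ^ 2 * Real.exp (-(0 / (4 * (L : ℝ) ^ s * (L : ℝ) ^ k))) * ∑ z, ‖g₀ z‖) := by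
    intro τ hτ hτ1
    obtain ⟨t, ht, ht1, htt⟩ : ∃ t : ℝ, 0 < t ∧ t ≤ 1 ∧ t ^ 2 = τ :=
      ⟨Real.sqrt τ, Real.sqrt_pos.2 hτ, by rw [← Real.sqrt_one]; exact Real.sqrt_le_sqrt hτ1, Real.sq_sqrt hτ.le⟩
    have ht2 : ((t ^ 2 : ℝ) : ℂ) ≠ 0 := Complex.ofReal_ne_zero.2 (pow_pos ht 2).ne'
    have hU := isUnit_nOp_add_mass hs hks e A (pow_pos ht 2) hak hΩ
    have hU₀ := isUnit_nOp_add_mass hs hks e A (pow_pos ht 2) hak hΩ₀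
    have happ : ∀ (X : Finset (Balaban1983to89.Site P 0)) (φ : Balaban1983to89.Site P 0 → ℂ),
        (nOp (B1RG242Torus.α P a k * (P.L : ℝ) ^ (k * P.d)) P.eps⁻¹ (expGauge P e A) k X
            + ((t ^ 2 : ℝ) : ℂ) • (1 : Matrix (Balaban1983to89.Site P 0) (Balaban1983to89.Site P 0) ℂ)) *ᵥ φ
          = nOp (B1RG242Torus.α P a k * (P.L : ℝ) ^ (k * P.d)) P.eps⁻¹ (expGauge P e A) k X *ᵥ φ + ((t ^ 2 : ℝ) : ℂ) • φ :=
      fun X φ => by rw [add_mulVec, smul_mulVec, one_mulVec]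
    obtain ⟨ψf, hTf⟩ := (Matrix.mulVec_surjective_iff_isUnit.2 hU) f
    obtain ⟨ψg, hTg⟩ := (Matrix.mulVec_surjective_iff_isUnit.2 hU) g
    obtain ⟨ψf₀, hTf₀⟩ := (Matrix.mulVec_surjective_iff_isUnit.2 hU₀) f
    obtain ⟨ψg₀, hTg₀⟩ := (Matrix.mulVec_surjective_iff_isUnit.2 hU₀) g₀
    have hψf : nOp (B1RG242Torus.α P a k * (P.L : ℝ) ^ (k * P.d)) P.eps⁻¹ (expGauge P e A) k Ω *ᵥ ψf
        + ((t ^ 2 : ℝ) : ℂ) • ψf = f := by rw [← happ]; exact hTf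
    have hψg : nOp (B1RG242Torus.α P a k * (P.L : ℝ) ^ (k * P.d)) P.eps⁻¹ (expGauge P e A) k Ω *ᵥ ψg
        + ((t ^ 2 : ℝ) : ℂ) • ψg = g := by rw [← happ]; exact hTg
    have hψf₀ : nOp (B1RG242Torus.α P a k * (P.L : ℝ) ^ (k * P.d)) P.eps⁻¹ (expGauge P e A) k Ω₀ *ᵥ ψf₀
        + ((t ^ 2 : ℝ) : ℂ) • ψf₀ = f := by rw [← happ]; exact hTf₀
    have hψg₀ : nOp (B1RG242Torus.α P a k * (P.L : ℝ) ^ (k * P.d)) P.eps⁻¹ (expGauge P e A) k Ω₀ *ᵥ ψg₀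
        + ((t ^ 2 : ℝ) : ℂ) • ψg₀ = g₀ := by rw [← happ]; exact hTg₀
    have hsf := support_of_massive_eq _ _ _ Ω ht2 hf hψf
    have hsg := support_of_massive_eq _ _ _ Ω ht2 hgsupp hψg
    have hsf₀ := support_of_massive_eq _ _ _ Ω₀ ht2 hf₀ hψf₀
    have hsg₀ := support_of_massive_eq _ _ _ Ω₀ ht2 hg₀supp hψg₀
    -- the resolvent identities
    have hres : g = ψf + ((t ^ 2 : ℝ) : ℂ) • ψg := by
      apply Matrix.mulVec_injective_iff_isUnit.2 hU
      show _ *ᵥ g = _ *ᵥ (ψf + ((t ^ 2 : ℝ) : ℂ) • ψg)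
      rw [mulVec_add, mulVec_smul, hTf, hTg, happ, hNg]
    have hres₀ : g₀ = ψf₀ + ((t ^ 2 : ℝ) : ℂ) • ψg₀ := by
      apply Matrix.mulVec_injective_iff_isUnit.2 hU₀
      show _ *ᵥ g₀ = _ *ᵥ (ψf₀ + ((t ^ 2 : ℝ) : ℂ) • ψg₀)
      rw [mulVec_add, mulVec_smul, hTf₀, hTg₀, happ, hNg₀]
    -- [B1] (2.26) for `ψf − ψf₀`, (2.25) at `D = 0` for `ψg`, `ψg₀`
    have hBd := norm_massive_diff_le d L s ha e creg β c₂ e₂ hB2 P hPd hPL hs hk1 hkK hks hsize hbig hbig₀ hsub A hec hece₂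
      hreg x hint ht ht1 hsf hsf₀ hf hψf hψf₀ M D D₀ D₁ hM hD hD₀ hD₁ hsupp hxD₀ hfD₁
    have hBg := norm_massive_solution_le d L s ha e creg β c₁ e₁ hB1 P hPd hPL hs hk1 hkK hks hsize hbig A hec hece₁ hregΩ x hint'
      ht ht1 hsg hgsupp hψg (∑ z, ‖g z‖) 0
      (fun z => Finset.single_le_sum (fun w _ => norm_nonneg (g w)) (Finset.mem_univ z)) le_rfl
      (fun z _ => Nat.cast_nonneg _)
    have hBg₀ := norm_massive_solution_le d L s ha e creg β c₁ e₁ hB1 P hPd hPL hs hk1 hkK hks hsize hbig₀ A hec hece₁ hreg x hint₀'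
      ht ht1 hsg₀ hg₀supp hψg₀ (∑ z, ‖g₀ z‖) 0
      (fun z => Finset.single_le_sum (fun w _ => norm_nonneg (g₀ w)) (Finset.mem_univ z)) le_rfl
      (fun z _ => Nat.cast_nonneg _)
    rw [congrFun hres x, congrFun hres₀ x, Pi.add_apply, Pi.smul_apply, Pi.add_apply, Pi.smul_apply,
      show ψf x + ((t ^ 2 : ℝ) : ℂ) • ψg x - (ψf₀ x + ((t ^ 2 : ℝ) : ℂ) • ψg₀ x)
        = (ψf x - ψf₀ x) + ((t ^ 2 : ℝ) : ℂ) • (ψg x - ψg₀ x) by rw [smul_sub]; ring]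
    refine (norm_add_le _ _).trans (add_le_add hBd ?_)
    rw [norm_smul, Complex.norm_real, Real.norm_of_nonneg (pow_pos ht 2).le, htt]
    exact mul_le_mul_of_nonneg_left ((norm_sub_le _ _).trans (add_le_add hBg hBg₀)) hτ.le
  -- `τ ↓ 0`
  refine le_of_forall_pos_le_add fun ε hε => ?_
  set Bg := c₁ * P.spacing k ^ 2 * Real.exp (-(0 / (4 * (L : ℝ) ^ s * (L : ℝ) ^ k))) * ∑ z, ‖g z‖
    + c₁ * P.spacing k ^ 2 * Real.exp (-(0 / (4 * (L : ℝ) ^ s * (L : ℝ) ^ k))) * ∑ z, ‖g₀ z‖ with hBg_def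
  have hBg0 : 0 ≤ Bg := by positivity
  have h := key (min 1 (ε / (Bg + 1))) (lt_min one_pos (div_pos hε (by linarith))) (min_le_left _ _)
  refine h.trans (add_le_add le_rfl ?_)
  calc min 1 (ε / (Bg + 1)) * Bg ≤ ε / (Bg + 1) * Bg := mul_le_mul_of_nonneg_right (min_le_right _ _) hBg0
    _ ≤ ε := by
      rw [div_mul_eq_mul_div, div_le_iff₀ (by linarith)]
      nlinarith

/-- **THE KERNEL FORM**: under the same hypotheses, for every `x` with `{|y − x| ≦ 2rS + 2L^kL^s(d+1) + 1} ⊂ Ω`, every `y ∈ Ω` and all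
`D₀ ≦ dist(x, T∖Ω)`, `D₁ ≦ dist(y, T∖Ω)`:  `|G_k(Ω,u;x,y) − G_k(Ω₀,u;x,y)| ≦ c₀(L^kε)²·exp(−(|x − y| + D₀ + D₁)/(8L^s·L^k))` — [7] Theorem p.573
(1.11)–(1.12) / [B1] (2.26) for the kernels, «exp(−δ₀(|x − x′| + dist(x,Ω^c) + dist(x′,Ω^c)))»-type factor with `δ₀ = 1/(8L^s)` per `L^kε`
(value member), from `norm_gBox_sub_gBox_mulVec_le` at `f = δ_y`. [cite: Balaban1983RegularityDecay, Theorem p.573 (1.11)–(1.12)] -/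
theorem norm_gBox_sub_gBox_apply_le (d L : ℕ) (hd : 1 ≤ d) (hL : 2 ≤ L) {a : ℝ} (ha : 0 < a) (e creg β : ℝ) (hcreg : 0 ≤ creg)
    (hβ : 0 < β) :
    ∃ s₀ : ℕ, ∀ s : ℕ, s₀ ≤ s → ∃ c₀ e₁ : ℝ, 0 < c₀ ∧ 0 < e₁ ∧
      ∀ (P : Params), P.d = d → P.L = L → ∀ {k : ℕ}, 1 ≤ k → k ≤ P.K → k + s ≤ P.m + P.K →
      3 * (L ^ k * L ^ s) ≤ P.sitesPerDir 0 →
      ∀ (Ω Ω₀ : Finset (Balaban1983to89.Site P 0)),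
        (∀ z z' : Balaban1983to89.Site P 0,
          (∀ μ, (z μ).val / (L ^ k * L ^ s) = (z' μ).val / (L ^ k * L ^ s)) → (z ∈ Ω ↔ z' ∈ Ω)) →
        (∀ z z' : Balaban1983to89.Site P 0,
          (∀ μ, (z μ).val / (L ^ k * L ^ s) = (z' μ).val / (L ^ k * L ^ s)) → (z ∈ Ω₀ ↔ z' ∈ Ω₀)) →
        Ω ⊆ Ω₀ →
      ∀ (A : PBond P 0 → ℝ) {ec : ℝ}, 0 < ec → ec ≤ e₁ →
      (∀ z ∈ Ω₀, ∀ μ ν : Fin P.d,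
          P.spacing k * |e| / ec * |A ⟨z.shift μ, ν⟩ - A ⟨z, ν⟩| ≤ creg * ec ^ (β - 1) / (L : ℝ) ^ k) →
      ∀ (x : Balaban1983to89.Site P 0),
        (∀ y, LatticeFieldCalculus.supDist x y
          ≤ 2 * (5 * (L ^ k * L ^ s) / 8 + L ^ k) + 2 * (L ^ k * L ^ s) * (d + 1) + 1 → y ∈ Ω) →
      ∀ y ∈ Ω, ∀ (D₀ D₁ : ℝ), 0 ≤ D₀ → 0 ≤ D₁ →
        (∀ z, z ∉ Ω → D₀ ≤ (LatticeFieldCalculus.supDist x z : ℝ)) →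
        (∀ z, z ∉ Ω → D₁ ≤ (LatticeFieldCalculus.supDist z y : ℝ)) →
        ‖gBox (B1RG242Torus.α P a k * (P.L : ℝ) ^ (k * P.d)) P.eps⁻¹ (expGauge P e A) k Ω x y
            - gBox (B1RG242Torus.α P a k * (P.L : ℝ) ^ (k * P.d)) P.eps⁻¹ (expGauge P e A) k Ω₀ x y‖
          ≤ c₀ * P.spacing k ^ 2
            * Real.exp (-(((LatticeFieldCalculus.supDist x y : ℝ) + D₀ + D₁) / (8 * (L : ℝ) ^ s * (L : ℝ) ^ k))) := by
  obtain ⟨s₀, hs₀⟩ := norm_gBox_sub_gBox_mulVec_le d L hd hL ha e creg β hcreg hβ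
  refine ⟨s₀, fun s hs => ?_⟩
  obtain ⟨c₀, e₁, hc₀, he₁, hmain⟩ := hs₀ s hs
  refine ⟨c₀, e₁, hc₀, he₁, ?_⟩
  intro P hPd hPL k hk1 hkK hks hsize Ω Ω₀ hbig hbig₀ hsub A ec hec hece hreg x hint y hy D₀ D₁ hD₀ hD₁ hxD₀ hyD₁
  have h := hmain P hPd hPL hk1 hkK hks hsize Ω Ω₀ hbig hbig₀ hsub A hec hece hreg x hint (Pi.single y 1) 1
    (LatticeFieldCalculus.supDist x y) D₀ D₁
    (fun z => by
      rw [Pi.single_apply]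
      split_ifs
      · rw [norm_one]
      · rw [norm_zero]; exact zero_le_one)
    (fun z hz => by
      rw [Pi.single_apply]
      split_ifs with hzy
      · exact absurd (hzy ▸ hy) hz
      · rfl)
    (Nat.cast_nonneg _) hD₀ hD₁
    (fun z hz => by
      rw [Pi.single_apply] at hz
      split_ifs at hz with hzy
      · rw [hzy]
      · exact absurd rfl hz)
    hxD₀
    (fun w z hw hz => by
      rw [Pi.single_apply] at hw
      split_ifs at hw with hwy
      · rw [hwy]; exact hyD₁ z hz
      · exact absurd rfl hw)
  rwa [mulVec_single, mulVec_single, MulOpposite.op_one, one_smul, one_smul, Matrix.col_apply, Matrix.col_apply, mul_one] at h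

end Close

/-! ## §3 The pair `Ω ⊂ Ω₀ = T^{(0)}` -/

section WholeTorus

/-- **THE PAIR `Ω ⊂ T^{(0)}`** (the whole torus is trivially a big-block union): for `u = e^{ieεA}` with `A` (2.23)-regular on all of `T^{(0)}`
(`0 < e_k ≦ e₁`), a big-block union `Ω`, every `x` with `{|y − x| ≦ 2rS + 2L^kL^s(d+1) + 1} ⊂ Ω`, every `f` supported in `Ω` with `|f| ≦ M`
vanishing on `{|z − x| < D}`, `D₀ ≦ dist(x, T∖Ω)`, `D₁ ≦ dist(supp f, T∖Ω)`:
`‖(G_k(Ω,u)f)(x) − (G_k(T,u)f)(x)‖ ≦ c₀(L^kε)²e^{−(D+D₀+D₁)/(8L^sL^k)}M` — the `δG_k(□, T_η)`-type closeness for p31's `gBox … k Ω` against the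
whole-torus `gBox … k univ` at a regular exponential field (at `A = 0` for torus cubes: this seat's `B4Delta112ZeroTorusCube`).
[cite: BalabanImbrieJaffe1985, p.326 «also satisfy the regularity and decay estimates of [7]»]
[cite: Balaban1983RegularityDecay, Theorem p.573 (1.11)–(1.12)] -/
theorem norm_gBox_sub_gBox_univ_mulVec_le (d L : ℕ) (hd : 1 ≤ d) (hL : 2 ≤ L) {a : ℝ} (ha : 0 < a) (e creg β : ℝ)
    (hcreg : 0 ≤ creg) (hβ : 0 < β) :
    ∃ s₀ : ℕ, ∀ s : ℕ, s₀ ≤ s → ∃ c₀ e₁ : ℝ, 0 < c₀ ∧ 0 < e₁ ∧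
      ∀ (P : Params), P.d = d → P.L = L → ∀ {k : ℕ}, 1 ≤ k → k ≤ P.K → k + s ≤ P.m + P.K →
      3 * (L ^ k * L ^ s) ≤ P.sitesPerDir 0 →
      ∀ (Ω : Finset (Balaban1983to89.Site P 0)),
        (∀ z z' : Balaban1983to89.Site P 0,
          (∀ μ, (z μ).val / (L ^ k * L ^ s) = (z' μ).val / (L ^ k * L ^ s)) → (z ∈ Ω ↔ z' ∈ Ω)) →
      ∀ (A : PBond P 0 → ℝ) {ec : ℝ}, 0 < ec → ec ≤ e₁ →
      (∀ (z : Balaban1983to89.Site P 0) (μ ν : Fin P.d),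
          P.spacing k * |e| / ec * |A ⟨z.shift μ, ν⟩ - A ⟨z, ν⟩| ≤ creg * ec ^ (β - 1) / (L : ℝ) ^ k) →
      ∀ (x : Balaban1983to89.Site P 0),
        (∀ y, LatticeFieldCalculus.supDist x y
          ≤ 2 * (5 * (L ^ k * L ^ s) / 8 + L ^ k) + 2 * (L ^ k * L ^ s) * (d + 1) + 1 → y ∈ Ω) →
      ∀ (f : Balaban1983to89.Site P 0 → ℂ) (M D D₀ D₁ : ℝ), (∀ z, ‖f z‖ ≤ M) → (∀ z, z ∉ Ω → f z = 0) →
        0 ≤ D → 0 ≤ D₀ → 0 ≤ D₁ →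
        (∀ z, f z ≠ 0 → D ≤ (LatticeFieldCalculus.supDist x z : ℝ)) →
        (∀ z, z ∉ Ω → D₀ ≤ (LatticeFieldCalculus.supDist x z : ℝ)) →
        (∀ y z, f y ≠ 0 → z ∉ Ω → D₁ ≤ (LatticeFieldCalculus.supDist z y : ℝ)) →
        ‖(gBox (B1RG242Torus.α P a k * (P.L : ℝ) ^ (k * P.d)) P.eps⁻¹ (expGauge P e A) k Ω *ᵥ f) x
            - (gBox (B1RG242Torus.α P a k * (P.L : ℝ) ^ (k * P.d)) P.eps⁻¹ (expGauge P e A) k Finset.univ *ᵥ f) x‖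
          ≤ c₀ * P.spacing k ^ 2 * Real.exp (-((D + D₀ + D₁) / (8 * (L : ℝ) ^ s * (L : ℝ) ^ k))) * M := by
  obtain ⟨s₀, hs₀⟩ := norm_gBox_sub_gBox_mulVec_le d L hd hL ha e creg β hcreg hβ
  refine ⟨s₀, fun s hs => ?_⟩
  obtain ⟨c₀, e₁, hc₀, he₁, hmain⟩ := hs₀ s hs
  refine ⟨c₀, e₁, hc₀, he₁, ?_⟩
  intro P hPd hPL k hk1 hkK hks hsize Ω hbig A ec hec hece hreg x hint f M D D₀ D₁ hM hf hD hD₀ hD₁ hsupp hxD₀ hfD₁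
  exact hmain P hPd hPL hk1 hkK hks hsize Ω Finset.univ hbig (fun z z' _ => by simp only [Finset.mem_univ])
    (Finset.subset_univ Ω) A hec hece (fun z _ μ ν => hreg z μ ν) x hint f M D D₀ D₁ hM hf hD hD₀ hD₁ hsupp hxD₀ hfD₁

end WholeTorus

/-! ## §4 The input shapes (H1.10)/(H1.12) of p31's `BIJ88DeltaLocClose235General` at a regular `u = e^{ieεA}`, level-`k` units -/

section InputShapes

variable {P : Params}

/-- kernel: the exponent of this lineage in p31's level-`k` units: `e^{−E/(c·L^s·L^k)} = e^{−(1/(cL^s))·((L^k)⁻¹E)}`. [folklore] -/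
private theorem exp_units (c Ls Lk E : ℝ) (hc : c ≠ 0) (hLs : Ls ≠ 0) (hLk : Lk ≠ 0) :
    Real.exp (-(E / (c * Ls * Lk))) = Real.exp (-(1 / (c * Ls) * (Lk⁻¹ * E))) := by
  congr 1
  field_simp

/-- kernel: `e^{−δE₊} ≤ e^{−δE}` for `δ ≥ 0`, `E ≤ E₊`. [folklore] -/
private theorem exp_le_exp_of_le {δ E E' : ℝ} (hδ : 0 ≤ δ) (hE : E ≤ E') :
    Real.exp (-(δ * E')) ≤ Real.exp (-(δ * E)) :=
  Real.exp_le_exp.2 (neg_le_neg (mul_le_mul_of_nonneg_left hE hδ))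

/-- **(H1.10) OF p31's `BIJ88DeltaLocClose235General` EXACTLY AS DISPLAYED THERE, FOR `X = T^{(0)}`, AT A REGULAR `u = e^{ieεA}`**: for `d ≧ 1`,
`L ≧ 2`, `a > 0`, `e`, `(c, β)`: `∃ s₀, ∀ s ≧ s₀, ∃ c₀ e₁ > 0` such that on every `Setup` torus, at every level `1 ≦ k ≦ K`, `k + s ≦ m + K`,
`3L^kL^s ≦ 2L^{m+K}`, for every `A` (2.23)-regular on `T^{(0)}` (`0 < e_k ≦ e₁`), EVERY row `x`, every complex source `f` with `‖f‖ ≦ F` supported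
at sup-torus distance `≧ D` from `x` (p38's metric `B5Ineq137Torus.T`, any real `D`):
`‖(G_k(T,u)f)(x)‖ ≦ s_k²·(c₀·e^{−δ₀·((L^k)⁻¹D)}·F)` with `δ₀ = 1/(4L^s)` — the companion file's `norm_gBox_univ_mulVec_le` ([7] (1.10) at
`Ω = T_η`: «the condition dist(x, Ω^c) ≧ R₀ is meaningless and is omitted»), restated in p31's units through `B3Bound323ZeroTorus.T_eq_supDist`.
[cite: Balaban1983RegularityDecay, Theorem p.573 (1.10)] [cite: BalabanImbrieJaffe1985, p.326 «also satisfy the regularity and decay estimates of [7]»] -/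
theorem input110_regular_univ (d L : ℕ) (hd : 1 ≤ d) (hL : 2 ≤ L) {a : ℝ} (ha : 0 < a) (e creg β : ℝ) (hcreg : 0 ≤ creg)
    (hβ : 0 < β) :
    ∃ s₀ : ℕ, ∀ s : ℕ, s₀ ≤ s → ∃ c₀ e₁ : ℝ, 0 < c₀ ∧ 0 < e₁ ∧
      ∀ (P : Params), P.d = d → P.L = L → ∀ {k : ℕ}, 1 ≤ k → k ≤ P.K → k + s ≤ P.m + P.K →
      3 * (L ^ k * L ^ s) ≤ P.sitesPerDir 0 →
      ∀ (A : PBond P 0 → ℝ) {ec : ℝ}, 0 < ec → ec ≤ e₁ →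
      (∀ (z : Balaban1983to89.Site P 0) (μ ν : Fin P.d),
          P.spacing k * |e| / ec * |A ⟨z.shift μ, ν⟩ - A ⟨z, ν⟩| ≤ creg * ec ^ (β - 1) / (L : ℝ) ^ k) →
      ∀ (x : Balaban1983to89.Site P 0) (f : Balaban1983to89.Site P 0 → ℂ) (F D : ℝ), (∀ y, ‖f y‖ ≤ F) →
        (∀ y, f y ≠ 0 → D ≤ B5Ineq137Torus.T P 0 x y) →
        ‖(gBox (B1RG242Torus.α P a k * (P.L : ℝ) ^ (k * P.d)) P.eps⁻¹ (expGauge P e A) k Finset.univ *ᵥ f) x‖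
          ≤ P.spacing k ^ 2 * ((c₀ * Real.exp (-(1 / (4 * (L : ℝ) ^ s) * (((P.L : ℝ) ^ k)⁻¹ * D)))) * F) := by
  obtain ⟨s₀, hs₀⟩ := norm_gBox_univ_mulVec_le d L hd hL ha e creg β hcreg hβ
  refine ⟨s₀, fun s hs => ?_⟩
  obtain ⟨c₀, e₁, hc₀, he₁, hmain⟩ := hs₀ s hs
  refine ⟨c₀, e₁, hc₀, he₁, ?_⟩
  intro P hPd hPL k hk1 hkK hks hsize A ec hec hece hreg x f F D hF hsD
  have hF0 : 0 ≤ F := (norm_nonneg _).trans (hF x)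
  have hLr : (0 : ℝ) < L := by exact_mod_cast (show 0 < L by omega)
  have hLs : (0 : ℝ) < (L : ℝ) ^ s := pow_pos hLr s
  have hLk : (0 : ℝ) < (L : ℝ) ^ k := pow_pos hLr k
  have h := hmain P hPd hPL hk1 hkK hks hsize A hec hece hreg x f F (max D 0) hF (le_max_right _ _)
    (fun z hz => by
      rw [← B3Bound323ZeroTorus.T_eq_supDist]
      exact max_le (hsD z hz) (B5Ineq137Torus.T_nonneg P 0 x z))
  have hPLk : ((L : ℝ) ^ k)⁻¹ = ((P.L : ℝ) ^ k)⁻¹ := by rw [hPL]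
  have hPk : (0 : ℝ) < (P.L : ℝ) ^ k := pow_pos P.cast_L_pos k
  rw [exp_units 4 ((L : ℝ) ^ s) ((L : ℝ) ^ k) (max D 0) four_ne_zero hLs.ne' hLk.ne', hPLk] at h
  calc _ ≤ c₀ * P.spacing k ^ 2 * Real.exp (-(1 / (4 * (L : ℝ) ^ s) * (((P.L : ℝ) ^ k)⁻¹ * max D 0))) * F := h
    _ ≤ c₀ * P.spacing k ^ 2 * Real.exp (-(1 / (4 * (L : ℝ) ^ s) * (((P.L : ℝ) ^ k)⁻¹ * D))) * F :=
        mul_le_mul_of_nonneg_right (mul_le_mul_of_nonneg_left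
          (exp_le_exp_of_le (by positivity) (mul_le_mul_of_nonneg_left (le_max_left _ _) (inv_pos.2 hPk).le))
          (by positivity)) hF0
    _ = _ := by ring

/-- **(H1.10) OF p31's `BIJ88DeltaLocClose235General` FOR A BIG-BLOCK UNION `X`, AT THE ROWS DEEP INSIDE `X`, AT A REGULAR `u = e^{ieεA}`**
(the print's «for x ∈ Ω, dist(x, Ω^c) ≧ R₀» — p31 displays (H1.10) at every row, which [7] prints «without any restrictions» only for
parallelepipeds): with the constants of `input110_regular_univ`'s sibling `norm_gBox_mulVec_le`, for every big-block union `X` (blocks `L^k·L^s`),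
every `A` (2.23)-regular on `X`, every row `x` with `{y : |y − x|_∞ ≦ 2rS + 2L^kL^s(d+1)} ⊂ X`, every `f` with `‖f‖ ≦ F` supported at sup-torus
distance `≧ D` from `x`:  `‖(G_k(X,u)f)(x)‖ ≦ s_k²·(c₀·e^{−δ₀·((L^k)⁻¹D)}·F)`, `δ₀ = 1/(4L^s)`.
[cite: Balaban1983RegularityDecay, Theorem p.573 (1.10)] [cite: BalabanImbrieJaffe1985, p.326 «also satisfy the regularity and decay estimates of [7]»] -/
theorem input110_regular_deep (d L : ℕ) (hd : 1 ≤ d) (hL : 2 ≤ L) {a : ℝ} (ha : 0 < a) (e creg β : ℝ) (hcreg : 0 ≤ creg)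
    (hβ : 0 < β) :
    ∃ s₀ : ℕ, ∀ s : ℕ, s₀ ≤ s → ∃ c₀ e₁ : ℝ, 0 < c₀ ∧ 0 < e₁ ∧
      ∀ (P : Params), P.d = d → P.L = L → ∀ {k : ℕ}, 1 ≤ k → k ≤ P.K → k + s ≤ P.m + P.K →
      3 * (L ^ k * L ^ s) ≤ P.sitesPerDir 0 →
      ∀ (X : Finset (Balaban1983to89.Site P 0)),
        (∀ z z' : Balaban1983to89.Site P 0,
          (∀ μ, (z μ).val / (L ^ k * L ^ s) = (z' μ).val / (L ^ k * L ^ s)) → (z ∈ X ↔ z' ∈ X)) →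
      ∀ (A : PBond P 0 → ℝ) {ec : ℝ}, 0 < ec → ec ≤ e₁ →
      (∀ z ∈ X, ∀ μ ν : Fin P.d,
          P.spacing k * |e| / ec * |A ⟨z.shift μ, ν⟩ - A ⟨z, ν⟩| ≤ creg * ec ^ (β - 1) / (L : ℝ) ^ k) →
      ∀ (x : Balaban1983to89.Site P 0),
        (∀ y, B5Ineq137Torus.T P 0 x y ≤ (2 * (5 * (L ^ k * L ^ s) / 8 + L ^ k) + 2 * (L ^ k * L ^ s) * (d + 1) : ℕ) → y ∈ X) →
      ∀ (f : Balaban1983to89.Site P 0 → ℂ) (F D : ℝ), (∀ y, ‖f y‖ ≤ F) →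
        (∀ y, f y ≠ 0 → D ≤ B5Ineq137Torus.T P 0 x y) →
        ‖(gBox (B1RG242Torus.α P a k * (P.L : ℝ) ^ (k * P.d)) P.eps⁻¹ (expGauge P e A) k X *ᵥ f) x‖
          ≤ P.spacing k ^ 2 * ((c₀ * Real.exp (-(1 / (4 * (L : ℝ) ^ s) * (((P.L : ℝ) ^ k)⁻¹ * D)))) * F) := by
  obtain ⟨s₀, hs₀⟩ := norm_gBox_mulVec_le d L hd hL ha e creg β hcreg hβ
  refine ⟨s₀, fun s hs => ?_⟩
  obtain ⟨c₀, e₁, hc₀, he₁, hmain⟩ := hs₀ s hs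
  refine ⟨c₀, e₁, hc₀, he₁, ?_⟩
  intro P hPd hPL k hk1 hkK hks hsize X hbig A ec hec hece hreg x hint f F D hF hsD
  have hF0 : 0 ≤ F := (norm_nonneg _).trans (hF x)
  have hLr : (0 : ℝ) < L := by exact_mod_cast (show 0 < L by omega)
  have hLs : (0 : ℝ) < (L : ℝ) ^ s := pow_pos hLr s
  have hLk : (0 : ℝ) < (L : ℝ) ^ k := pow_pos hLr k
  have h := hmain P hPd hPL hk1 hkK hks hsize X hbig A hec hece hreg x
    (fun y hy => hint y (by
      rw [B3Bound323ZeroTorus.T_eq_supDist]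
      exact_mod_cast hy))
    f F (max D 0) hF (le_max_right _ _)
    (fun z hz => by
      rw [← B3Bound323ZeroTorus.T_eq_supDist]
      exact max_le (hsD z hz) (B5Ineq137Torus.T_nonneg P 0 x z))
  have hPLk : ((L : ℝ) ^ k)⁻¹ = ((P.L : ℝ) ^ k)⁻¹ := by rw [hPL]
  have hPk : (0 : ℝ) < (P.L : ℝ) ^ k := pow_pos P.cast_L_pos k
  rw [exp_units 4 ((L : ℝ) ^ s) ((L : ℝ) ^ k) (max D 0) four_ne_zero hLs.ne' hLk.ne', hPLk] at h
  calc _ ≤ c₀ * P.spacing k ^ 2 * Real.exp (-(1 / (4 * (L : ℝ) ^ s) * (((P.L : ℝ) ^ k)⁻¹ * max D 0))) * F := h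
    _ ≤ c₀ * P.spacing k ^ 2 * Real.exp (-(1 / (4 * (L : ℝ) ^ s) * (((P.L : ℝ) ^ k)⁻¹ * D))) * F :=
        mul_le_mul_of_nonneg_right (mul_le_mul_of_nonneg_left
          (exp_le_exp_of_le (by positivity) (mul_le_mul_of_nonneg_left (le_max_left _ _) (inv_pos.2 hPk).le))
          (by positivity)) hF0
    _ = _ := by ring

/-- **(H1.12′) — THE SHAPE OF p31's (H1.12) THAT [7] PRINTS AT `A ≠ 0`, AT A REGULAR `u = e^{ieεA}`**: for `d ≧ 1`, `L ≧ 2`, `a > 0`, `e`,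
`(c, β)`: `∃ s₀, ∀ s ≧ s₀, ∃ c₀ e₁ > 0` such that on every `Setup` torus, `1 ≦ k ≦ K`, `k + s ≦ m + K`, `3L^kL^s ≦ 2L^{m+K}`, for every pair
`□ ⊆ Ω` of big-block unions (blocks `L^k·L^s`; p31's `B ⊆ X`), every `A` (2.23)-regular on `Ω`, every row `x` WITH
`{y : |y − x|_∞ ≦ 2rS + 2L^kL^s(d+1) + 1} ⊂ □` («with the same restrictions on x»), every `f` supported in `□` with `‖f‖ ≦ F` at sup-torus
distance `≧ D` from `x`, all reals `D_b, D_f` dominated by the sup-torus distances from `x`, resp. from `supp f`, TO `T ∖ □` («Ω^c means a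
complement in T_η»):  `‖(G_k(□,u)f)(x) − (G_k(Ω,u)f)(x)‖ ≦ s_k²·(c₀·e^{−δ₀·((L^k)⁻¹D)}·e^{−δ₀·((L^k)⁻¹(D_b+D_f))}·F)`, `δ₀ = 1/(8L^s)` —
`norm_gBox_sub_gBox_mulVec_le` in p31's level-`k` units and p38's metric (`B3Bound323ZeroTorus.T_eq_supDist`).  Differences from the displayed
(H1.12): the row restriction, and `w ∉ □` in place of `w ∈ Ω, w ∉ □` in the two boundary-distance hypotheses.
[cite: Balaban1983RegularityDecay, Theorem p.573 (1.11)–(1.12)] [cite: Balaban1982Higgs1, Prop. 2.1 (2.26) pp.610–611]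
[cite: BalabanImbrieJaffe1985, p.326 «also satisfy the regularity and decay estimates of [7]»] -/
theorem input112_regular_deep (d L : ℕ) (hd : 1 ≤ d) (hL : 2 ≤ L) {a : ℝ} (ha : 0 < a) (e creg β : ℝ) (hcreg : 0 ≤ creg)
    (hβ : 0 < β) :
    ∃ s₀ : ℕ, ∀ s : ℕ, s₀ ≤ s → ∃ c₀ e₁ : ℝ, 0 < c₀ ∧ 0 < e₁ ∧
      ∀ (P : Params), P.d = d → P.L = L → ∀ {k : ℕ}, 1 ≤ k → k ≤ P.K → k + s ≤ P.m + P.K →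
      3 * (L ^ k * L ^ s) ≤ P.sitesPerDir 0 →
      ∀ (B X : Finset (Balaban1983to89.Site P 0)),
        (∀ z z' : Balaban1983to89.Site P 0,
          (∀ μ, (z μ).val / (L ^ k * L ^ s) = (z' μ).val / (L ^ k * L ^ s)) → (z ∈ B ↔ z' ∈ B)) →
        (∀ z z' : Balaban1983to89.Site P 0,
          (∀ μ, (z μ).val / (L ^ k * L ^ s) = (z' μ).val / (L ^ k * L ^ s)) → (z ∈ X ↔ z' ∈ X)) →
        B ⊆ X →
      ∀ (A : PBond P 0 → ℝ) {ec : ℝ}, 0 < ec → ec ≤ e₁ →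
      (∀ z ∈ X, ∀ μ ν : Fin P.d,
          P.spacing k * |e| / ec * |A ⟨z.shift μ, ν⟩ - A ⟨z, ν⟩| ≤ creg * ec ^ (β - 1) / (L : ℝ) ^ k) →
      ∀ (x : Balaban1983to89.Site P 0),
        (∀ y, B5Ineq137Torus.T P 0 x y
          ≤ (2 * (5 * (L ^ k * L ^ s) / 8 + L ^ k) + 2 * (L ^ k * L ^ s) * (d + 1) + 1 : ℕ) → y ∈ B) →
      ∀ (f : Balaban1983to89.Site P 0 → ℂ) (F D Db Df : ℝ), (∀ y, ‖f y‖ ≤ F) → (∀ y, y ∉ B → f y = 0) →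
        (∀ y, f y ≠ 0 → D ≤ B5Ineq137Torus.T P 0 x y) → (∀ w, w ∉ B → Db ≤ B5Ineq137Torus.T P 0 x w) →
        (∀ y, f y ≠ 0 → ∀ w, w ∉ B → Df ≤ B5Ineq137Torus.T P 0 y w) →
        ‖(gBox (B1RG242Torus.α P a k * (P.L : ℝ) ^ (k * P.d)) P.eps⁻¹ (expGauge P e A) k B *ᵥ f) x
            - (gBox (B1RG242Torus.α P a k * (P.L : ℝ) ^ (k * P.d)) P.eps⁻¹ (expGauge P e A) k X *ᵥ f) x‖
          ≤ P.spacing k ^ 2 * (c₀ * Real.exp (-(1 / (8 * (L : ℝ) ^ s) * (((P.L : ℝ) ^ k)⁻¹ * D)))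
              * Real.exp (-(1 / (8 * (L : ℝ) ^ s) * (((P.L : ℝ) ^ k)⁻¹ * (Db + Df)))) * F) := by
  obtain ⟨s₀, hs₀⟩ := norm_gBox_sub_gBox_mulVec_le d L hd hL ha e creg β hcreg hβ
  refine ⟨s₀, fun s hs => ?_⟩
  obtain ⟨c₀, e₁, hc₀, he₁, hmain⟩ := hs₀ s hs
  refine ⟨c₀, e₁, hc₀, he₁, ?_⟩
  intro P hPd hPL k hk1 hkK hks hsize B X hbig hbigX hsub A ec hec hece hreg x hint f F D Db Df hF hfB hsD hsDb hsDf
  have hF0 : 0 ≤ F := (norm_nonneg _).trans (hF x)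
  have hLr : (0 : ℝ) < L := by exact_mod_cast (show 0 < L by omega)
  have hLs : (0 : ℝ) < (L : ℝ) ^ s := pow_pos hLr s
  have hLk : (0 : ℝ) < (L : ℝ) ^ k := pow_pos hLr k
  have h := hmain P hPd hPL hk1 hkK hks hsize B X hbig hbigX hsub A hec hece hreg x
    (fun y hy => hint y (by
      rw [B3Bound323ZeroTorus.T_eq_supDist]
      exact_mod_cast hy))
    f F (max D 0) (max Db 0) (max Df 0) hF hfB (le_max_right _ _) (le_max_right _ _) (le_max_right _ _)
    (fun z hz => by
      rw [← B3Bound323ZeroTorus.T_eq_supDist]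
      exact max_le (hsD z hz) (B5Ineq137Torus.T_nonneg P 0 x z))
    (fun z hz => by
      rw [← B3Bound323ZeroTorus.T_eq_supDist]
      exact max_le (hsDb z hz) (B5Ineq137Torus.T_nonneg P 0 x z))
    (fun y z hy hz => by
      rw [← B3Bound323ZeroTorus.T_eq_supDist, B5Ineq137Torus.T_symm]
      exact max_le (hsDf y hy z hz) (B5Ineq137Torus.T_nonneg P 0 y z))
  have hPLk : ((L : ℝ) ^ k)⁻¹ = ((P.L : ℝ) ^ k)⁻¹ := by rw [hPL]
  have hPk : (0 : ℝ) < (P.L : ℝ) ^ k := pow_pos P.cast_L_pos k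
  rw [exp_units 8 ((L : ℝ) ^ s) ((L : ℝ) ^ k) (max D 0 + max Db 0 + max Df 0) (by norm_num) hLs.ne' hLk.ne', hPLk] at h
  have hδ : (0 : ℝ) ≤ 1 / (8 * (L : ℝ) ^ s) := by positivity
  calc _ ≤ c₀ * P.spacing k ^ 2
        * Real.exp (-(1 / (8 * (L : ℝ) ^ s) * (((P.L : ℝ) ^ k)⁻¹ * (max D 0 + max Db 0 + max Df 0)))) * F := h
    _ ≤ c₀ * P.spacing k ^ 2 * (Real.exp (-(1 / (8 * (L : ℝ) ^ s) * (((P.L : ℝ) ^ k)⁻¹ * D)))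
          * Real.exp (-(1 / (8 * (L : ℝ) ^ s) * (((P.L : ℝ) ^ k)⁻¹ * (Db + Df))))) * F := by
        refine mul_le_mul_of_nonneg_right (mul_le_mul_of_nonneg_left ?_ (by positivity)) hF0
        rw [← Real.exp_add]
        refine Real.exp_le_exp.2 ?_
        have hLki : (0 : ℝ) ≤ ((P.L : ℝ) ^ k)⁻¹ := (inv_pos.2 hPk).le
        have h1 : D + (Db + Df) ≤ max D 0 + max Db 0 + max Df 0 := by
          linarith [le_max_left D 0, le_max_left Db 0, le_max_left Df 0]
        nlinarith [mul_le_mul_of_nonneg_left (mul_le_mul_of_nonneg_left h1 hLki) hδ]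
    _ = _ := by ring

end InputShapes

end

end Literature.MathematicalPhysics.QuantumFieldTheory.BalabanImbrieJaffe1984to88.BIJ85NeumannPropagatorRegularClose
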